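import Summits.QuantumFields.YangMills.Theses.FixedTorusFirst
import Summits.QuantumFields.YangMills.Theorems.FixedTorusFirstSomeTorusDetectorOfExtraction
import Summits.QuantumFields.YangMills.Theorems.UniversalDetectorBlindSeqExtraction

/-!
# `FixedTorusFirst.SomeTorusDetector` (item stmt-QuantumFields-24177) — proof

Support item of LINE g11-2 «engine tori» (planner ym-idea-8 g11) on route `FixedTorusFirst` (YangMills, rung R2a, crux
`BalabanLadder.NT` = stmt-QuantumFields-19353): the blind universal detector run along ONE engine torus `Lsel β` per
coupling (`a(β)·Lsel(β) → ∞`).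

Three-line closing file: the planner's Theorems-side composition `someTorusDetector_of_blindSeqExtraction` (✓p707923;
`BlindSeqExtraction → SomeTorusDetector`, with the landed `BlindDetectorRigidity` ✓p705845 of ym-line-sfw-p2-w4 and the
planner's `CompactDetectorTransfer` ✓p707314 plugged in) applied to the fleet lead's landed SEQUENTIAL extraction
`Cruxes.UniversalDetectorBlindExtraction.blindSeqExtraction` (✓p707587, ym-spine-19353-p1 g26), which serves any
torus-selection scheme.

HONEST FRAMING: a support item; the cruxes `SomeTorusEdgeBit` (24174), `FiniteSizeInsensitivity` (27355), the residual
`SkewOnSomeTorus` (24178), the rung `BalabanLadder.NT` and every summit statement remain open; the Yang–Mills mass gap is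
NOT proved by this. [folklore]
-/

set_option autoImplicit false

namespace Summit.QuantumFields.YangMills.Theorems

/-- **`FixedTorusFirst.SomeTorusDetector` holds** (item stmt-QuantumFields-24177, BY NAME): blind sequential extraction along
the engine tori + blind detector rigidity + compact-support transfer of the universal detector. [folklore] -/
theorem fixedTorusFirst_someTorusDetector_proof :
    Summit.QuantumFields.YangMills.Theses.FixedTorusFirst.SomeTorusDetector :=
  Summit.QuantumFields.YangMills.Cruxes.FixedTorusFirstEngineTori.someTorusDetector_of_blindSeqExtraction
    Summit.QuantumFields.YangMills.Cruxes.UniversalDetectorBlindExtraction.blindSeqExtraction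

end Summit.QuantumFields.YangMills.Theorems
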